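import Mathlib.Data.ZMod.Basic
import Mathlib.Tactic.Ring
import Mathlib.Tactic.NormNum
import Mathlib.Tactic.DeriveFintype
import HarnessLib

/-!
# The gauge-fixed Conway–Lagarias cochain for stone tilings: finite facts (kernel)

ω-census `pub-omega`, family (b3), seat pub-omega-group gen 32.  Framing: lottery ticket; floor = certified bounds/negative
ranges.  VALUE: kernel certification of the FINITE ingredients (F1, F2, F4 and the unit-step bound) of the cell's paper-grade
theorem "every partition of `ℤ_n² ∖ {pt}` (3 ∤ n) into translates of `{0,e₁,e₂}` and `{0,−e₁,−e₂}` has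
`|#up − #down| ≤ (10n+6)/9`" (RESULTS-g32, HOME/pub-omega-group-g32/), whose only non-finite ingredient is a planar van Kampen
lemma; NOT progress on ω, and NOT a proof of that theorem.

Setting (RESULTS-g32 §1).  Faces of the triangular lattice: `U(x,y) = {(x,y),(x+1,y),(x,y+1)}`, `D(x,y) = {(x,y),(x−1,y),(x,y−1)}`;
two faces are adjacent across a lattice edge of direction `h` (e₁), `v` (e₂) or `d` (e₂ − e₁); the neighbour of a face across a
label is unique (`Kind.nbr`), and its colour `col = x − y (mod 3)` changes by `Kind.dcol`.  The Conway–Lagarias shadow of a walk,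
after dividing out the (tiling-independent, flat) S₃ linear part, is the lattice walk with steps
`step (kind, col) label = σ(kind,col) · β(label)` where `σ(U,c) = rot^c`, `σ(D,c) = rot^c ∘ swapD` and `β(h) = (−1,1,0)`,
`β(v) = (0,−1,1)`, `β(d) = (1,0,−1)` (three times the barycentre displacements of the alcove walk).  Everything only depends on
`(kind, col) ∈ Kind × ZMod 3`, so all facts below are decided by `decide`; translating a face by `t` multiplies all steps by
`rot^{col t}` (built into the parametrisation).  `ω` is (nine times) the area form; `area2` of a step list is twice the signed
(shoelace) area of its polygon of partial sums.
* `hexagon_facts` (F1): the six hexagon loops at any face (`(vdh)²`, `(hdv)²` and rotations) are closed, have curl in the six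
  vectors `±(3,−6,3), ±(−6,3,3), ±(3,3,−6)` and `|area2| = 9`.
* `stone_facts` (F2): the boundary loop of every up-stone (word `vdvdhvhvdhdh` from the face `D` below-left of the centre) is
  closed with curl `0` and `area2 = −54`; every down-stone (`vhvdhdhvdvdh`): curl `0`, `area2 = +54`.
  [Conway–Lagarias 1990: "T₂ words have winding ±3"; here in gauge-fixed integer units, `54 = 2·3·9`.]
* `heis_triple_area` (F4): in the Heisenberg group `(v,a)·(w,b) = (v+w, a+b+ω(v,w))`, for `ℓ_j = (rot^j c, a)`,
  `g_j = (rot^j v, b)`: `area(ℓ₀g₀ℓ₁g₁ℓ₂g₂) − area(g₀g₁g₂) = 3a + 3ω(c,v) + ω(c,ρc) + ω(c,ρv) + ω(v,ρc)` identically (`ring`).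
* `step_functional_bound`: for every curl vector `c`, `ρ ∈ {rot, rot²}` and unit step `s`:
  `3ω(c,s) + ω(c,ρs) + ω(s,ρc) ∈ {0, ±54}`, and `|ω(c,ρc)| = 81` — the coefficients behind `|9Δ| ≤ 6 + 3m`.
-/

namespace Summit.MatrixMultiplication.OmegaCensus.StoneShadow

/-- Integer vectors (three times the alcove-barycentre coordinates of RESULTS-g32 §1). [folklore] -/
abbrev V := ℤ × ℤ × ℤ

/-- Nine times the area form of the `A₂` plane, in the coordinates `x ↦ (x₁ − x₂, x₂ − x₃)`. [folklore] -/
def areaForm (u w : V) : ℤ := (u.1 - u.2.1) * (w.2.1 - w.2.2) - (u.2.1 - u.2.2) * (w.1 - w.2.1)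

/-- The 3-cycle `ρ_{e₁}` (linear part of the shadow holonomy along `e₁`): cyclic shift of coordinates. [folklore] -/
def rot (w : V) : V := (w.2.1, w.2.2, w.1)

/-- The transposition `(13)` = linear part of the generator labelled `d`. [folklore] -/
def swapD (w : V) : V := (w.2.2, w.2.1, w.1)

/-- `rot^c` for `c : ZMod 3`. [folklore] -/
def rotPow (c : ZMod 3) (w : V) : V := match c with
  | 0 => w
  | 1 => rot w
  | 2 => rot (rot w)

/-- Face kinds: up- and down-triangles. [folklore] -/
inductive Kind | U | D
  deriving DecidableEq, Repr, Fintype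

/-- Edge labels = directions of lattice edges: `h` = e₁, `v` = e₂, `d` = e₂ − e₁. [folklore] -/
inductive Lab | h | v | d
  deriving DecidableEq, Repr, Fintype

/-- The kind of the neighbour across a label (faces alternate). [folklore] -/
def Kind.other : Kind → Kind | .U => .D | .D => .U

/-- Offset of the neighbouring face's anchor: `U(x,y)` –h→ `D(x+1,y)`, –v→ `D(x,y+1)`, –d→ `D(x+1,y+1)`; `D(x,y)` –h→ `U(x−1,y)`,
–v→ `U(x,y−1)`, –d→ `U(x−1,y−1)`. [folklore] -/
def Kind.offset : Kind → Lab → ℤ × ℤ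
  | .U, .h => (1, 0) | .U, .v => (0, 1) | .U, .d => (1, 1)
  | .D, .h => (-1, 0) | .D, .v => (0, -1) | .D, .d => (-1, -1)

/-- Change of colour `col = x − y (mod 3)` across a label. [folklore] -/
def Kind.dcol (k : Kind) (l : Lab) : ZMod 3 := ((k.offset l).1 - (k.offset l).2 : ℤ)

/-- Abstract state of a face for the purpose of shadow steps: (kind, colour). [folklore] -/
abbrev State := Kind × ZMod 3

/-- The neighbouring state across a label. [folklore] -/
def State.nbr (s : State) (l : Lab) : State := (s.1.other, s.2 + s.1.dcol l)

/-- `β(label)`: three times the displacement of the alcove barycentre under the corresponding generator. [folklore] -/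
def betaStep : Lab → V | .h => (-1, 1, 0) | .v => (0, -1, 1) | .d => (1, 0, -1)

/-- The background linear part `σ` applied to a vector: `σ(U,c) = rot^c`, `σ(D,c) = rot^c ∘ swapD`. [folklore] -/
def State.sigma (s : State) (w : V) : V := match s.1 with
  | .U => rotPow s.2 w
  | .D => rotPow s.2 (swapD w)

/-- The gauge-fixed shadow step across a label. [folklore] -/
def State.step (s : State) (l : Lab) : V := s.sigma (betaStep l)

/-- The shadow steps of the walk reading a label word from a state. [folklore] -/
def State.steps : State → List Lab → List V
  | _, [] => []
  | s, l :: w => s.step l :: (s.nbr l).steps w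

/-- The final state after reading a word. [folklore] -/
def State.run : State → List Lab → State
  | s, [] => s
  | s, l :: w => (s.nbr l).run w

/-- Total anchor displacement and final kind after reading a word from a kind (position-independent). [folklore] -/
def Kind.displacement : Kind → List Lab → Kind × (ℤ × ℤ)
  | k, [] => (k, (0, 0))
  | k, l :: w => let r := k.other.displacement w; (r.1, ((k.offset l).1 + r.2.1, (k.offset l).2 + r.2.2))

/-- Curl (total displacement) of a step list. [folklore] -/
def curl (L : List V) : V := L.foldr (fun s acc => (s.1 + acc.1, s.2.1 + acc.2.1, s.2.2 + acc.2.2)) (0, 0, 0)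

/-- Twice the signed area of the polygon of partial sums: `Σ_{i<j} ω(s_i, s_j)`. [folklore] -/
def area2 : List V → ℤ
  | [] => 0
  | s :: L => (L.map (areaForm s)).foldr (· + ·) 0 + area2 L

/-- The six hexagon words at a face: `(vdh)²` and its rotations (counter-clockwise around the three vertices of an up-face)
and `(hdv)²` and its rotations (clockwise). [folklore] -/
def hexWords : List (List Lab) :=
  [[.v,.d,.h,.v,.d,.h], [.d,.h,.v,.d,.h,.v], [.h,.v,.d,.h,.v,.d], [.h,.d,.v,.h,.d,.v], [.d,.v,.h,.d,.v,.h], [.v,.h,.d,.v,.h,.d]]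

/-- The six hexagon curls (three times the vectors `c` of RESULTS-g32 F1). [folklore] -/
def curls : List V := [(3,-6,3), (-6,3,3), (3,3,-6), (-3,6,-3), (6,-3,-3), (-3,-3,6)]

/-- The six unit steps (the `S₃`-orbit of `betaStep`). [folklore] -/
def star : List V := [(-1,1,0), (0,-1,1), (1,0,-1), (1,-1,0), (0,1,-1), (-1,0,1)]

/-- **F1 (hexagons).** From every state, each of the six hexagon words returns to the starting face (zero anchor displacement,
same kind and colour), has curl among the six curl vectors, and twice-area `±9`. [folklore] -/
theorem hexagon_facts :
    ∀ s : State, ∀ w ∈ hexWords,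
      s.run w = s ∧ s.1.displacement w = (s.1, (0, 0)) ∧ curl (s.steps w) ∈ curls ∧ (area2 (s.steps w)).natAbs = 9 := by
  decide

/-- Every shadow step is a unit step of the star. [folklore] -/
theorem step_mem_star : ∀ s : State, ∀ l : Lab, s.step l ∈ star := by decide

/-- Steps are antisymmetric: crossing back gives the negative step. [folklore] -/
theorem step_nbr_neg : ∀ s : State, ∀ l : Lab,
    (s.nbr l).step l = (-(s.step l).1, -(s.step l).2.1, -(s.step l).2.2) ∧ (s.nbr l).nbr l = s := by decide

/-- **F2 (stones).** The boundary of the up-stone centred at `U(x,y)`, read counter-clockwise from `D(x,y)` (same colour), is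
the word `vdvdhvhvdhdh`: it closes up, has curl `0` and twice-area `−54`; the boundary of the down-stone centred at `D(x,y)`,
read counter-clockwise from `D(x−1,y)` (colour `− 1`), is `vhvdhdhvdvdh`: closed, curl `0`, twice-area `+54`.  (All stones:
the statement is for every colour.) [folklore] -/
theorem stone_facts : ∀ c : ZMod 3,
    (let s : State := (.D, c); let w : List Lab := [.v,.d,.v,.d,.h,.v,.h,.v,.d,.h,.d,.h];
      s.run w = s ∧ Kind.displacement .D w = (.D, (0, 0)) ∧ curl (s.steps w) = (0, 0, 0) ∧ area2 (s.steps w) = -54) ∧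
    (let s : State := (.D, c - 1); let w : List Lab := [.v,.h,.v,.d,.h,.d,.h,.v,.d,.v,.d,.h];
      s.run w = s ∧ Kind.displacement .D w = (.D, (0, 0)) ∧ curl (s.steps w) = (0, 0, 0) ∧ area2 (s.steps w) = 54) := by
  decide

/-- **Unit-step bound for the linear functional `ℓ_c`.**  For every curl vector `c`, both 3-cycles `ρ` and every unit step
`s`: `2·ℓ_c(s) = 3ω(c,s) + ω(c,ρs) + ω(s,ρc) ∈ {0, 54, −54}`, and `|ω(c, ρc)| = 81`. [folklore] -/
theorem step_functional_bound :
    ∀ c ∈ curls, ∀ s ∈ star,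
      (3 * areaForm c s + areaForm c (rot s) + areaForm s (rot c) = 0 ∨ 3 * areaForm c s + areaForm c (rot s) + areaForm s (rot c) = 54 ∨
          3 * areaForm c s + areaForm c (rot s) + areaForm s (rot c) = -54) ∧
      (3 * areaForm c s + areaForm c (rot (rot s)) + areaForm s (rot (rot c)) = 0 ∨ 3 * areaForm c s + areaForm c (rot (rot s)) + areaForm s (rot (rot c)) = 54 ∨
          3 * areaForm c s + areaForm c (rot (rot s)) + areaForm s (rot (rot c)) = -54) ∧
      (areaForm c (rot c)).natAbs = 81 ∧ (areaForm c (rot (rot c))).natAbs = 81 := by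
  decide

/-- Heisenberg multiplication on `V × ℤ` with the (doubled) area cocycle `ω`. [folklore] -/
def hmul (x y : V × ℤ) : V × ℤ := ((x.1.1 + y.1.1, x.1.2.1 + y.1.2.1, x.1.2.2 + y.1.2.2), x.2 + y.2 + areaForm x.1 y.1)

/-- `ω` is invariant under the 3-cycle `rot`. [folklore] -/
theorem areaForm_rot (u w : V) : areaForm (rot u) (rot w) = areaForm u w := by
  unfold areaForm rot; ring

/-- **F4 (three-period Heisenberg identity).**  With `ℓ_j = (rot^j c, a)` (hole loop) and `g_j = (rot^j v, b)` (one period of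
the cut curve), the area parts satisfy
`area(ℓ₀ g₀ ℓ₁ g₁ ℓ₂ g₂) − area(g₀ g₁ g₂) = 3a + 3ω(c,v) + ω(c, rot c) + ω(c, rot v) + ω(v, rot c)`
(twice the `F_c(v)` of RESULTS-g32 in these doubled units) — an unconditional polynomial identity. [folklore] -/
theorem heis_triple_area (c v : V) (a b : ℤ) :
    (hmul (hmul (hmul (hmul (hmul (c, a) (v, b)) (rot c, a)) (rot v, b)) (rot (rot c), a)) (rot (rot v), b)).2 -
        (hmul (hmul (v, b) (rot v, b)) (rot (rot v), b)).2 =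
      3 * a + 3 * areaForm c v + areaForm c (rot c) + (areaForm c (rot v) + areaForm v (rot c)) := by
  obtain ⟨c₁, c₂, c₃⟩ := c
  obtain ⟨v₁, v₂, v₃⟩ := v
  simp only [hmul, areaForm, rot]
  ring

/-- The translation part of three consecutive periods vanishes in the area plane: `ω(w + rot w + rot² w, ·) = 0`
(`1 + ρ + ρ² = 0` on the `A₂` plane). [folklore] -/
theorem areaForm_three_periods (w u : V) :
    areaForm (w.1 + (rot w).1 + (rot (rot w)).1, w.2.1 + (rot w).2.1 + (rot (rot w)).2.1,
        w.2.2 + (rot w).2.2 + (rot (rot w)).2.2) u = 0 := by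
  obtain ⟨w₁, w₂, w₃⟩ := w
  simp only [areaForm, rot]
  ring

end Summit.MatrixMultiplication.OmegaCensus.StoneShadow
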